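import Summits.QuantumFields.YangMills.Theorems.BalabanUVNodesN21TiltedFibreProfileLinear

/-!
# N21 (NE7c) · THE LINEAR TILTED LETTER IN THE FIBRED FRAME: the exterior tilts the letter through a bounded linear
# response — (M1) constant `e·max(θ(aθ + Λ_b), 1)` uniform in the exterior, `Λ_b` the profile pairing

R141 (C) seat pub-ymgap-dag-n21-e (g17), node N21 = NE7c (single-run shell-weight bound, NOT PRINTED in [Bałaban
1983–89], NOT proved), strategy s3 ALTERNATIVE CURRENCY, lane K3⁷ `SpineGivenEndpointR13SepCoPH`
(stmt-QuantumFields-20544, `--kind proof --supports … --as helper`).  Part 38p′ of this seat's series = §5 of 38p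
`…N21TiltedFibreProfileLinear` (split for the 400-line rule); item (w-e) of the g16 HANDOFF's open list.

WHAT.  38p §3 ★ `slotAntiConcentration_tiltedLetter_linear(_abs)` gives (M1) for the tilted Gaussian letter
`e^{−(½at² + ht)}` on `[−θ, θ]` with the LINEAR constant `e·max(θ(aθ + |h|), 1)` (lens g31 CORRECTION OF RECORD N211 ∕
Card 90).  Here the tilt is produced by the EXTERIOR: law `ζ` on any measurable space `X` (no finiteness needed),
tilt `h : X → ℝ` measurable with `|h z| ≤ H`; the joint law `(ζ ⊗ vol|[−θ,θ]).withDensity e^{−(½a·q.2² + h(q.1)·q.2)}`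
with the letter coordinate as tested variable satisfies (M1) with `D = e·max(θ(aθ + H), 1)` — 38p §3 on every
exterior fibre, integrated by 38j §1 `measure_le_mul_of_fibrewise` BY NAME (★★ `…_fibred`, ★★ `…_fibred_abs`);
with `h z = Σ_y R_y·Z z y`, `|Z z y| ≤ Θ_y`, the bound `H = Σ_y |R_y|Θ_y` is the PROFILE PAIRING `Λ_b` of 38o §1
(`abs_response_le_profile` BY NAME): ★★★ `slotAntiConcentration_tiltedLetter_linear_profile` — lens N211's
sentence «`D ≲ e(x_b² + θ_bΛ_b)`, not `e^{θ_bΛ_b}`» in the kernel; A6 `tiltedLetterLinearFibred_binders_inhabited`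
(one-point exterior, every binder discharged).

HONEST FRAMING.  [textbook] Tonelli + by-name composition (38p §3, 38j §1, 38o §1,
`T4ShellMeasureFibre.slotAntiConcentration_mono`); 0 def, 0 sorry.  `a = A_bb`, `R = A_b,ext`, `Θ_y`, `θ_b`, `ρ` are
HYPOTHESES (lens packaging N212, NOT-IN-PRINT as one function; desk ROW Q″ = [LF-I] = CMP 122 pp.184–186 located
MECHANISM only); the conditional slope bound for the ACTUAL (2.18) fibre law is NOT claimed; nothing of Bałaban's
asserted; NE7c NOT PRINTED ∕ NOT proved; N21 NOT discharged; counts unmoved (typed 28∕28 · discharged 5∕27);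
count-neutral; one finite 𝕋⁴ at fixed ε — nothing about ℝ⁴ ∕ OS ∕ mass gap ∕ Clay.
-/

set_option autoImplicit false

open MeasureTheory Set Function
open scoped ENNReal

namespace Summit.QuantumFields.YangMills.Theorems.N21TiltedFibreProfileLinearFibred

open Literature.MathematicalPhysics.QuantumFieldTheory.Balaban1983to89.T4ShellMeasure
  (SlotAntiConcentration shell_eq_preimage)
open Literature.MathematicalPhysics.QuantumFieldTheory.Balaban1983to89.T4ShellMeasureFibre
  (slotAntiConcentration_mono)
open Summit.QuantumFields.YangMills.Theorems.N21CollarOddsBlockFrame (measure_le_mul_of_fibrewise)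
open Summit.QuantumFields.YangMills.Theorems.N21TiltedFibreProfile (abs_response_le_profile)
open Summit.QuantumFields.YangMills.Theorems.N21TiltedFibreProfileLinear
  (slotAntiConcentration_tiltedLetter_linear slotAntiConcentration_tiltedLetter_linear_abs)

/-! ## §5 (of 38p)  The fibred frame: the exterior tilts the letter through a bounded linear response -/

section Fibred

variable {X : Type*} [MeasurableSpace X] (ζ : Measure X)

/-- ★★ **THE EXTERIOR-TILTED LETTER SATISFIES (M1), LINEAR CONSTANT UNIFORM IN THE EXTERIOR.**  Exterior law `ζ` on any
`X` (no finiteness needed), tilt `h : X → ℝ` measurable with `|h z| ≤ H`; the joint law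
`(ζ ⊗ vol|[−θ,θ]).withDensity e^{−(½a·q.2² + h(q.1)·q.2)}` with the letter coordinate as tested variable satisfies
`SlotAntiConcentration … (q ↦ q.2) θ ρ (e·max(θ(aθ + H), 1))` — §3 ★ on every exterior fibre, integrated by 38j §1
`measure_le_mul_of_fibrewise` BY NAME. [textbook] -/
theorem slotAntiConcentration_tiltedLetter_linear_fibred {a θ ρ H : ℝ} (ha : 0 ≤ a) (hθ : 0 < θ) (hρ : 0 < ρ)
    (hρ1 : ρ ≤ 1) {h : X → ℝ} (hh : Measurable h) (hhH : ∀ z, |h z| ≤ H) :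
    SlotAntiConcentration
      ((ζ.prod ((volume : Measure ℝ).restrict (Icc (-θ) θ))).withDensity
        fun q : X × ℝ => ENNReal.ofReal (Real.exp (-(a / 2 * q.2 ^ 2 + h q.1 * q.2)))) (fun q => q.2) θ ρ
      (Real.exp 1 * max (θ * (a * θ + H)) 1) := by
  unfold SlotAntiConcentration
  have hS : MeasurableSet {q : X × ℝ | θ * (1 - ρ) ≤ q.2 ∧ q.2 < θ} := by
    rw [shell_eq_preimage]; exact measurable_snd measurableSet_Ico
  have hWm : Measurable fun q : X × ℝ => a / 2 * q.2 ^ 2 + h q.1 * q.2 :=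
    ((measurable_snd.pow_const 2).const_mul _).add ((hh.comp measurable_fst).mul measurable_snd)
  have hg : Measurable fun q : X × ℝ => ENNReal.ofReal (Real.exp (-(a / 2 * q.2 ^ 2 + h q.1 * q.2))) :=
    ENNReal.measurable_ofReal.comp (Real.measurable_exp.comp hWm.neg)
  refine measure_le_mul_of_fibrewise ζ _ hg hS MeasurableSet.univ _ fun z => ?_
  have h1 := slotAntiConcentration_tiltedLetter_linear (h := h z) ha hθ hρ hρ1
  have h2 : Real.exp 1 * max (θ * (a * θ + |h z|)) 1 ≤ Real.exp 1 * max (θ * (a * θ + H)) 1 :=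
    mul_le_mul_of_nonneg_left
      (max_le_max (mul_le_mul_of_nonneg_left (add_le_add le_rfl (hhH z)) hθ.le) le_rfl) (Real.exp_pos 1).le
  have h3 := slotAntiConcentration_mono hρ.le h2 h1
  unfold SlotAntiConcentration at h3
  simpa only [preimage_setOf_eq, preimage_univ] using h3

/-- ★★ the same for the two-sided statistic `|q.2|`, `D = 2e·max(θ(aθ + H), 1)`. [textbook] -/
theorem slotAntiConcentration_tiltedLetter_linear_fibred_abs {a θ ρ H : ℝ} (ha : 0 ≤ a) (hθ : 0 < θ)
    (hρ : 0 < ρ) (hρ1 : ρ ≤ 1) {h : X → ℝ} (hh : Measurable h) (hhH : ∀ z, |h z| ≤ H) :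
    SlotAntiConcentration
      ((ζ.prod ((volume : Measure ℝ).restrict (Icc (-θ) θ))).withDensity
        fun q : X × ℝ => ENNReal.ofReal (Real.exp (-(a / 2 * q.2 ^ 2 + h q.1 * q.2)))) (fun q => |q.2|) θ ρ
      (2 * (Real.exp 1 * max (θ * (a * θ + H)) 1)) := by
  unfold SlotAntiConcentration
  have hS : MeasurableSet {q : X × ℝ | θ * (1 - ρ) ≤ |q.2| ∧ |q.2| < θ} := by
    rw [shell_eq_preimage]; exact (continuous_abs.measurable.comp measurable_snd) measurableSet_Ico
  have hWm : Measurable fun q : X × ℝ => a / 2 * q.2 ^ 2 + h q.1 * q.2 :=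
    ((measurable_snd.pow_const 2).const_mul _).add ((hh.comp measurable_fst).mul measurable_snd)
  have hg : Measurable fun q : X × ℝ => ENNReal.ofReal (Real.exp (-(a / 2 * q.2 ^ 2 + h q.1 * q.2))) :=
    ENNReal.measurable_ofReal.comp (Real.measurable_exp.comp hWm.neg)
  refine measure_le_mul_of_fibrewise ζ _ hg hS MeasurableSet.univ _ fun z => ?_
  have h1 := slotAntiConcentration_tiltedLetter_linear_abs (h := h z) ha hθ hρ hρ1
  have h2 : 2 * (Real.exp 1 * max (θ * (a * θ + |h z|)) 1) ≤ 2 * (Real.exp 1 * max (θ * (a * θ + H)) 1) :=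
    mul_le_mul_of_nonneg_left (mul_le_mul_of_nonneg_left
      (max_le_max (mul_le_mul_of_nonneg_left (add_le_add le_rfl (hhH z)) hθ.le) le_rfl) (Real.exp_pos 1).le)
      (by norm_num)
  have h3 := slotAntiConcentration_mono hρ.le h2 h1
  unfold SlotAntiConcentration at h3
  simpa only [preimage_setOf_eq, preimage_univ] using h3

/-- ★★★ **THE PROFILE LETTER, LINEAR** (lens N211 ∕ Card 90 in the kernel).  Exterior configuration
`Z : X → (Y → ℝ)` measurable with `|Z z y| ≤ Θ_y` (the sizes permitted to the exterior variables), tilt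
`h z = Σ_y R_y·Z z y` (the linear response at the letter, `R = A_b,ext`): the (M1) constant of the tested letter is
`e·max(θ(aθ + Λ), 1)` with `Λ = Σ_y |R_y|Θ_y` the PROFILE PAIRING of 38o §1 (`abs_response_le_profile` BY NAME) —
`D ≲ e(x_b² + θ_bΛ_b)`, not `e^{θ_bΛ_b}`. [textbook] -/
theorem slotAntiConcentration_tiltedLetter_linear_profile {Y : Type*} [Fintype Y] {a θ ρ : ℝ} (ha : 0 ≤ a)
    (hθ : 0 < θ) (hρ : 0 < ρ) (hρ1 : ρ ≤ 1) (R Θ : Y → ℝ) {Z : X → Y → ℝ} (hZ : Measurable Z)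
    (hZΘ : ∀ z y, |Z z y| ≤ Θ y) :
    SlotAntiConcentration
      ((ζ.prod ((volume : Measure ℝ).restrict (Icc (-θ) θ))).withDensity
        fun q : X × ℝ => ENNReal.ofReal (Real.exp (-(a / 2 * q.2 ^ 2 + (∑ y, R y * Z q.1 y) * q.2))))
      (fun q => q.2) θ ρ (Real.exp 1 * max (θ * (a * θ + ∑ y, |R y| * Θ y)) 1) := by
  have hh : Measurable fun z : X => ∑ y, R y * Z z y :=
    Finset.measurable_sum _ fun y _ => ((measurable_pi_apply y).comp hZ).const_mul _
  have key := slotAntiConcentration_tiltedLetter_linear_fibred ζ (h := fun z : X => ∑ y, R y * Z z y)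
    (H := ∑ y, |R y| * Θ y) ha hθ hρ hρ1 hh
    fun z => abs_response_le_profile (κ := Unit) (fun _ => R) (Z z) Θ (hZΘ z) ()
  exact key

/-- A6 (director-ym STANDING A6 RULE №189 (3)): ★★ with every binder discharged — one-point exterior, `a = θ = H = 1`,
constant tilt `h ≡ 1`, `ρ = ½`. [bookkeeping] -/
theorem tiltedLetterLinearFibred_binders_inhabited :
    SlotAntiConcentration
      (((Measure.dirac ()).prod ((volume : Measure ℝ).restrict (Icc (-1) 1))).withDensity
        fun q : Unit × ℝ => ENNReal.ofReal (Real.exp (-(1 / 2 * q.2 ^ 2 + (fun _ : Unit => (1 : ℝ)) q.1 * q.2))))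
      (fun q => q.2) 1 (1 / 2) (Real.exp 1 * max (1 * (1 * 1 + 1)) 1) := by
  have key := @slotAntiConcentration_tiltedLetter_linear_fibred Unit _ (Measure.dirac ()) 1 1 (1 / 2) 1
    (by norm_num) one_pos (by norm_num) (by norm_num) (fun _ => 1) measurable_const (fun _ => by simp)
  exact key

end Fibred

end Summit.QuantumFields.YangMills.Theorems.N21TiltedFibreProfileLinearFibred
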